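import Summits.CriticalPhenomena.SAWScalingLimit.Theorems.SAWCircleScreeningScreeningRecursionScreen
import Summits.CriticalPhenomena.SAWScalingLimit.Theorems.SAWCircleScreeningScreeningRecursionScreens
import Summits.CriticalPhenomena.SAWScalingLimit.Theorems.SAWCircleScreeningScreeningRecursionScreensWalk
import HarnessLib

/-!
# Screening recursion for `SAWCircleScreening`, part XII: the exact screen at the event level

Route `SAWCircleScreening` of `CriticalPhenomena/SAWScalingLimit`, support item
`ScreeningRecursion` (stmt-CriticalPhenomena-5468). Part VIII proved the exact screen for a FIXED
prefix `α` (cylinder factorisation over `(Ω₀ ∖ K, α) ↝ (Ω₀ ∖ K_s, y)`). Here we sum over the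
prefixes: for the canonical-screen event `E_{(j,x,y)}` (smallest grid radius `r = 2ρ + jδ ≤ 3ρ`
crossed exactly once, exit edge `(x, y)`) and any observable `Φ` of the support that forgets
initial segments inside `B(c, R⋆)`, `R⋆ ≥ 3ρ + δ`,

  `law (Ω₀∖K) (E ∩ {Φ ∈ A}) = law (Ω₀∖K) E · law (Ω₀∖K_s) {β from y | Φ β ∈ A}`
  (`law_screen_event`),

the second factor being independent of the near data `K ⊆ B̄(c, ρ)` and of the start `a`.
Ingredients: the decomposition `support = ins ++ out` at the first exit of `B(c, r)`
(`List.findIdx`), the transfer lemma `screen_iff_of_decomp` (part XI), `law_split_gen`,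
`transport_T1_gen`, `screen_T2` (part VIII), and finite additivity over the finitely many
prefixes. Folklore (Kesten's bridge renewal, radial form).
-/

noncomputable section

open Set Metric MeasureTheory
open scoped ENNReal
open Literature.Probability.LatticeModels
open Literature.Probability.RandomPlanarGeometry
open Literature.Probability.RandomPlanarGeometry.SAW

namespace Summit.CriticalPhenomena.SAWScalingLimit.Theorems.ScreeningRecursion

variable {δ : ℝ} {c : ℂ}

/-! ## The decomposition at the first exit of `B(c, r)` -/

/-- The first-exit decomposition: if the first point of `l` is inside `B(c, r)` and the last one
outside, then with `n = l.findIdx (outside)`: `0 < n < |l|`, the first `n` points are inside and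
the `n`-th is outside. [folklore] -/
theorem firstExit_spec {r : ℝ} (l : List (Site 2)) (hl : l ≠ [])
    (h0 : dist (meshPoint δ (l.head hl)) c < r) (hlast : r ≤ dist (meshPoint δ (l.getLast hl)) c) :
    0 < l.findIdx (fun w => decide (r ≤ dist (meshPoint δ w) c)) ∧
    (∃ hn : l.findIdx (fun w => decide (r ≤ dist (meshPoint δ w) c)) < l.length,
      r ≤ dist (meshPoint δ (l[l.findIdx (fun w => decide (r ≤ dist (meshPoint δ w) c))])) c) ∧
    ∀ w ∈ l.take (l.findIdx (fun w => decide (r ≤ dist (meshPoint δ w) c))),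
      dist (meshPoint δ w) c < r := by
  set P : Site 2 → Bool := fun w => decide (r ≤ dist (meshPoint δ w) c) with hP
  have hn : l.findIdx P < l.length :=
    List.findIdx_lt_length_of_exists ⟨l.getLast hl, List.getLast_mem hl, by simpa [hP] using hlast⟩
  refine ⟨?_, ⟨hn, by simpa [hP] using (List.findIdx_getElem (p := P) (w := hn))⟩, ?_⟩
  · rcases Nat.eq_zero_or_pos (l.findIdx P) with h | h
    · exfalso
      have h1 := List.findIdx_getElem (p := P) (w := hn)
      simp only [h] at h1
      rw [← List.head_eq_getElem_zero hl] at h1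
      have : r ≤ dist (meshPoint δ (l.head hl)) c := by simpa [hP] using h1
      linarith
    · exact h
  · intro w hw
    obtain ⟨i, hi, rfl⟩ := List.getElem_of_mem hw
    rw [List.length_take] at hi
    rw [List.getElem_take]
    have := List.not_of_lt_findIdx (p := P) (show i < l.findIdx P by omega)
    simp only [hP, decide_eq_false_iff_not, not_le] at this
    exact this

/-- The first exit index of a decomposed list `ins ++ out` (`ins` inside, head of `out` outside)
is `|ins|`. [folklore] -/
theorem findIdx_of_decomp {r : ℝ} (ins out : List (Site 2)) (hin : ∀ w ∈ ins, dist (meshPoint δ w) c < r)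
    (hout : out ≠ []) (hhead : r ≤ dist (meshPoint δ (out.head hout)) c) :
    (ins ++ out).findIdx (fun w => decide (r ≤ dist (meshPoint δ w) c)) = ins.length := by
  set P : Site 2 → Bool := fun w => decide (r ≤ dist (meshPoint δ w) c) with hP
  rw [List.findIdx_eq (by rw [List.length_append]; have := List.length_pos_iff.2 hout; omega)]
  constructor
  · rw [List.getElem_append_right (le_refl _)]
    simp only [Nat.sub_self]
    rw [← List.head_eq_getElem_zero hout]
    simpa [hP] using hhead
  · intro i hi
    rw [List.getElem_append_left hi]
    have := hin _ (List.getElem_mem hi)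
    simpa [hP] using this

/-! ## Finite partitions of a measure on a finite discrete type -/

/-- On a finite measurable space with all sets measurable, the measure of `S` is the sum over the
values `π` of a map `f` of the measures of `S ∩ {f = π}`. [folklore] -/
theorem measure_eq_sum_fiber {X Y : Type*} [MeasurableSpace X] [MeasurableSingletonClass X]
    [Fintype X] [DecidableEq Y] (hmeas : ∀ s : Set X, MeasurableSet s) (μ : Measure X) (f : X → Y)
    (S : Set X) : μ S = ∑ π ∈ Finset.univ.image f, μ (S ∩ f ⁻¹' {π}) := by
  classical
  have hS : S = ⋃ π ∈ Finset.univ.image f, (S ∩ f ⁻¹' {π}) := by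
    ext x
    simp only [mem_iUnion, mem_inter_iff, mem_preimage, mem_singleton_iff, Finset.mem_image,
      Finset.mem_univ, true_and, exists_prop]
    exact ⟨fun hx => ⟨f x, ⟨x, rfl⟩, hx, rfl⟩, fun ⟨_, _, hx, _⟩ => hx⟩
  conv_lhs => rw [hS]
  rw [measure_biUnion_finset]
  · intro π _ π' _ hne
    exact Disjoint.mono inter_subset_right inter_subset_right
      (Disjoint.preimage f (disjoint_singleton.2 hne))
  · exact fun π _ => hmeas _

/-! ## The exact screen at the event level -/

section ScreenLaw

local notation3 "ScrEv[" δ ", " c ", " ρ "](" j ", " x ", " y " ; " l ")" =>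
  (2 * ρ + (j : ℝ) * δ ≤ 3 * ρ ∧
    (∃ k : ℕ, (∀ i : ℕ, (hi : i < List.length l) →
        (dist (meshPoint δ (l[i])) c < 2 * ρ + (j : ℝ) * δ ↔ i ≤ k)) ∧
      l[k]? = some x ∧ l[k + 1]? = some y) ∧
    ∀ j' : ℕ, j' < j → ¬ ∃ k : ℕ, ∀ i : ℕ, (hi : i < List.length l) →
        (dist (meshPoint δ (l[i])) c < 2 * ρ + (j' : ℝ) * δ ↔ i ≤ k))

/-- **The exact screen.** Let `Ω₀` be bounded and flat at `c` up to `ρ₀ > 3ρ + δ`; near data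
`K ⊆ B̄(c, ρ)`, `2δ ≤ ρ`; start `a` within `ρ` of `c`, target `b` at distance `≥ 3ρ + δ`, with
`b ∈ (Ω₀ ∖ K)_δ` and `b ∈ (Ω₀ ∖ K_s)_δ` where `K_s = B(c, r) ∖ chords`, `r = 2ρ + jδ ≤ 3ρ`.
Let `Φ` be an observable of vertex lists with `Φ (pfx ++ l) = Φ l` whenever `pfx ⊆ B(c, R⋆)` and
the head of `l ≠ []` is in `B(c, R⋆)`, `R⋆ ≥ 3ρ + δ`. Then for every `A`,
`law (Ω₀∖K) a b (E_{(j,x,y)} ∩ {Φ ∈ A}) = law (Ω₀∖K) a b E_{(j,x,y)} · law (Ω₀∖K_s) y b {Φ ∈ A}`.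
[folklore] -/
theorem law_screen_event {Ω₀ K : Set ℂ} {u : ℂ} {ρ₀ ρ : ℝ} {a b : Site 2}
    (hΩ₀ : Bornology.IsBounded Ω₀)
    (hflat : Ω₀ ∩ ball c ρ₀ = {z | 0 < ((z - c) * u).im} ∩ ball c ρ₀)
    (hδ : 0 < δ) (hδρ : 2 * δ ≤ ρ) (hρρ₀ : 3 * ρ + δ < ρ₀) (hK : K ⊆ closedBall c ρ)
    (ha : dist (meshPoint δ a) c ≤ ρ) (hbfar : 3 * ρ + δ ≤ dist (meshPoint δ b) c)
    (j : ℕ) (x y : Site 2) (hj : 2 * ρ + j * δ ≤ 3 * ρ) {Ks : Set ℂ}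
    (hKs : Ks = ball c (2 * ρ + j * δ) \ {z | ∃ x' y' : Site 2, (zdGraph 2).Adj x' y' ∧
      2 * ρ + j * δ ≤ dist (meshPoint δ x') c ∧ 2 * ρ + j * δ ≤ dist (meshPoint δ y') c ∧
      z ∈ segment ℝ (meshPoint δ x') (meshPoint δ y')})
    (hb : b ∈ meshDomain (Ω₀ \ K) δ) (hbs : b ∈ meshDomain (Ω₀ \ Ks) δ)
    {Z : Type*} (Φ : List (Site 2) → Z) {Rstar : ℝ} (hRstar : 3 * ρ + δ ≤ Rstar)
    (hΦ : ∀ pfx l : List (Site 2), (∀ w ∈ pfx, dist (meshPoint δ w) c < Rstar) →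
      (∃ h : l ≠ [], dist (meshPoint δ (l.head h)) c < Rstar) → Φ (pfx ++ l) = Φ l)
    (A : Set Z) :
    law (Ω₀ \ K) δ a b {γ | ScrEv[δ, c, ρ](j, x, y ; γ.walk.support) ∧ Φ γ.walk.support ∈ A} =
      law (Ω₀ \ K) δ a b {γ | ScrEv[δ, c, ρ](j, x, y ; γ.walk.support)} *
        law (Ω₀ \ Ks) δ y b {β | Φ β.walk.support ∈ A} := by
  classical
  set r : ℝ := 2 * ρ + j * δ with hr
  have hr2 : 2 * ρ ≤ r := by
    have : (0:ℝ) ≤ j * δ := by positivity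
    linarith
  have hrρ : ρ < r - δ := by linarith
  set P : Site 2 → Bool := fun w => decide (r ≤ dist (meshPoint δ w) c) with hP
  haveI := TPToTraversalBound.Radial.finite_domainSAW (hΩ₀.subset Set.sdiff_subset) hδ a b
    (Ω := Ω₀ \ K)
  haveI := Fintype.ofFinite (DomainSAW (Ω₀ \ K) δ a b)
  -- the screen prefix of a walk: up to and including the first vertex outside `B(c, r)`
  set pf : DomainSAW (Ω₀ \ K) δ a b → List (Site 2) :=
    fun γ => γ.walk.support.take (γ.walk.support.findIdx P + 1) with hpf
  set E : Set (DomainSAW (Ω₀ \ K) δ a b) := {γ | ScrEv[δ, c, ρ](j, x, y ; γ.walk.support)} with hE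
  set B : Set (DomainSAW (Ω₀ \ K) δ a b) := {γ | Φ γ.walk.support ∈ A} with hB
  set Q : ℝ≥0∞ := law (Ω₀ \ Ks) δ y b {β | Φ β.walk.support ∈ A} with hQ
  change law (Ω₀ \ K) δ a b (E ∩ B) = law (Ω₀ \ K) δ a b E * Q
  -- basic facts about any walk `γ`
  have hne : ∀ γ : DomainSAW (Ω₀ \ K) δ a b, γ.walk.support ≠ [] := fun γ =>
    SimpleGraph.Walk.support_ne_nil _
  have hhead : ∀ γ : DomainSAW (Ω₀ \ K) δ a b, (γ.walk.support.head (hne γ)) = a := fun γ => by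
    simp only [SimpleGraph.Walk.head_support]
  have hlast : ∀ γ : DomainSAW (Ω₀ \ K) δ a b, (γ.walk.support.getLast (hne γ)) = b := fun γ =>
    SimpleGraph.Walk.getLast_support _
  have hfe : ∀ γ : DomainSAW (Ω₀ \ K) δ a b, 0 < γ.walk.support.findIdx P ∧
      (∃ hn : γ.walk.support.findIdx P < γ.walk.support.length,
        r ≤ dist (meshPoint δ (γ.walk.support[γ.walk.support.findIdx P])) c) ∧
      ∀ w ∈ γ.walk.support.take (γ.walk.support.findIdx P), dist (meshPoint δ w) c < r := by
    intro γ
    refine firstExit_spec γ.walk.support (hne γ) ?_ ?_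
    · rw [hhead]; linarith
    · rw [hlast]; linarith
  -- Step 1: partition by the screen prefix
  rw [measure_eq_sum_fiber (fun _ => MeasurableSpace.measurableSet_top) _ pf (E ∩ B),
    measure_eq_sum_fiber (fun _ => MeasurableSpace.measurableSet_top) _ pf E, Finset.sum_mul]
  refine Finset.sum_congr rfl fun π _ => ?_
  -- Step 2: the fibre of `π`
  by_cases hempty : E ∩ pf ⁻¹' {π} = ∅
  · have h1 : E ∩ B ∩ pf ⁻¹' {π} = ∅ := by
      rw [inter_assoc, inter_comm B, ← inter_assoc, hempty, empty_inter]
    rw [h1, hempty, measure_empty, zero_mul]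
  obtain ⟨γ₁, hγ₁E, hγ₁π⟩ := nonempty_iff_ne_empty.2 hempty
  rw [mem_preimage, mem_singleton_iff] at hγ₁π
  -- decomposition of `γ₁`
  obtain ⟨hn0, ⟨hnlt, hnout⟩, hinside⟩ := hfe γ₁
  set n := γ₁.walk.support.findIdx P with hn_def
  set ins := γ₁.walk.support.take n with hins_def
  set out := γ₁.walk.support.drop n with hout_def
  have hdec : γ₁.walk.support = ins ++ out := (List.take_append_drop n _).symm
  have hinslen : ins.length = n := by rw [hins_def, List.length_take]; omega
  have hinsne : ins ≠ [] := by rw [← List.length_pos_iff, hinslen]; exact hn0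
  have houtne : out ≠ [] := by
    rw [← List.length_pos_iff, hout_def, List.length_drop]; omega
  have houthead : out.head houtne = γ₁.walk.support[n] := by
    simp only [hout_def, List.head_drop]
  have houthd : r ≤ dist (meshPoint δ (out.head houtne)) c := by rw [houthead]; exact hnout
  have hsc1 : ∃ k : ℕ, ∀ i : ℕ, (hi : i < (ins ++ out).length) →
      (dist (meshPoint δ ((ins ++ out)[i])) c < r ↔ i ≤ k) := by
    rw [← hdec]; exact hγ₁E.2.1.imp fun k hk => hk.1
  have hallout : ∀ w ∈ out, r ≤ dist (meshPoint δ w) c :=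
    (sc_iff_forall_of_decomp ins out hinsne hinside houtne houthd).1 hsc1
  have hE1' : ScrEv[δ, c, ρ](j, x, y ; (ins ++ out)) := by rw [← hdec]; exact hγ₁E
  obtain ⟨-, hxlast, hyhead, -⟩ := (screen_iff_of_decomp hδ.le ins out hinsne hinside houtne hallout).1 hE1'
  have hπ : π = ins ++ [y] := by
    rw [← hγ₁π, hpf]
    show γ₁.walk.support.take (n + 1) = ins ++ [y]
    rw [← List.take_append_getElem hnlt, ← hyhead, houthead]
  have hπlen : π.length - 1 = ins.length := by rw [hπ, List.length_append]; simp
  have hπne : π ≠ [] := by rw [hπ]; simp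
  have hπlast : π.getLast hπne = y := by simp [hπ]
  have hπdrop : π.dropLast = ins := by rw [hπ]; simp
  -- the `π`-cylinder with suffix outside
  set C : List (Site 2) → Prop := fun l => π <+: l ∧ ∀ w ∈ l.drop (π.length - 1),
    r ≤ dist (meshPoint δ w) c with hC
  -- Step 3: the fibre is the `C`-cylinder
  have hfib : E ∩ pf ⁻¹' {π} = {γ | C γ.walk.support} := by
    ext γ
    simp only [mem_inter_iff, mem_preimage, mem_singleton_iff, mem_setOf_eq, hC]
    constructor
    · rintro ⟨hγE, hγπ⟩
      obtain ⟨hm0, ⟨hmlt, hmout⟩, hinside'⟩ := hfe γ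
      set m := γ.walk.support.findIdx P with hm_def
      have hdec' : γ.walk.support = γ.walk.support.take m ++ γ.walk.support.drop m :=
        (List.take_append_drop m _).symm
      have hπ' : π = γ.walk.support.take m ++ [γ.walk.support[m]] := by
        rw [← hγπ, hpf]
        show γ.walk.support.take (m + 1) = _
        rw [← List.take_append_getElem hmlt]
      have hmn : m = ins.length := by
        have h1 := congrArg List.length hπ'
        rw [hπ] at h1
        simp only [List.length_append, List.length_singleton, List.length_take,
          min_eq_left hmlt.le] at h1
        omega
      refine ⟨?_, ?_⟩
      · rw [← hγπ, hpf]; exact List.take_prefix _ _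
      · intro w hw
        rw [hπlen, ← hmn] at hw
        have houtne' : γ.walk.support.drop m ≠ [] := by
          rw [← List.length_pos_iff, List.length_drop]; omega
        have hsc' : ∃ k : ℕ, ∀ i : ℕ, (hi : i < (γ.walk.support.take m ++ γ.walk.support.drop m).length) →
            (dist (meshPoint δ ((γ.walk.support.take m ++ γ.walk.support.drop m)[i])) c < r ↔ i ≤ k) := by
          rw [← hdec']; exact hγE.2.1.imp fun k hk => hk.1
        have hne' : γ.walk.support.take m ≠ [] := by
          rw [← List.length_pos_iff, List.length_take]; omega
        exact (sc_iff_forall_of_decomp _ _ hne' hinside' houtne'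
          (by simp only [List.head_drop]; exact hmout)).1 hsc' w hw
    · rintro ⟨hpre, hout'⟩
      obtain ⟨rest, hrest⟩ := hpre
      have hdec' : γ.walk.support = ins ++ (y :: rest) := by
        rw [← hrest, hπ, List.append_assoc]; rfl
      have hall' : ∀ w ∈ y :: rest, r ≤ dist (meshPoint δ w) c := by
        intro w hw
        refine hout' w ?_
        rw [hdec', hπlen, List.drop_left]
        exact hw
      constructor
      · show ScrEv[δ, c, ρ](j, x, y ; γ.walk.support)
        rw [hdec']
        refine (screen_iff_of_decomp hδ.le ins (y :: rest) hinsne hinside (List.cons_ne_nil _ _) hall').2 ?_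
        obtain ⟨h1, h2, -, h4⟩ := (screen_iff_of_decomp hδ.le ins out hinsne hinside houtne hallout).1 hE1'
        exact ⟨h1, h2, rfl, h4⟩
      · show pf γ = π
        rw [hpf]
        show γ.walk.support.take (γ.walk.support.findIdx P + 1) = π
        rw [hdec', findIdx_of_decomp ins (y :: rest) hinside (List.cons_ne_nil _ _)
          (hall' y List.mem_cons_self), List.take_length_add_append, hπ]
        simp
  -- Step 4: on the `C`-cylinder, `Φ` only sees the suffix
  have hΦC : ∀ γ : DomainSAW (Ω₀ \ K) δ a b, C γ.walk.support →
      (Φ γ.walk.support ∈ A ↔ γ.walk.support.drop (π.length - 1) ∈ {l | Φ l ∈ A}) := by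
    rintro γ ⟨⟨rest, hrest⟩, -⟩
    have hdec' : γ.walk.support = ins ++ (y :: rest) := by
      rw [← hrest, hπ, List.append_assoc]; rfl
    rw [mem_setOf_eq, hdec', hπlen, List.drop_left, hΦ ins (y :: rest)]
    · intro w hw; have := hinside w hw; linarith
    · refine ⟨List.cons_ne_nil _ _, ?_⟩
      simp only [List.head_cons]
      -- `y` is adjacent to `x ∈ ins`, inside: `dist y ≤ dist x + δ < r + δ ≤ R⋆`
      have hadj : (zdGraph 2).Adj x y := by
        have hk := hE1'.2.1
        obtain ⟨k, -, hkx, hky⟩ := hk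
        rw [← hdec] at hkx hky
        have hk1 : k + 1 < γ₁.walk.support.length := by
          rcases Nat.lt_or_ge (k + 1) γ₁.walk.support.length with h | h
          · exact h
          · rw [List.getElem?_eq_none h] at hky; exact absurd hky (by simp)
        have e1 := getVert_eq_getElem_support γ₁.walk (show k < _ by omega)
        have e2 := getVert_eq_getElem_support γ₁.walk hk1
        rw [List.getElem?_eq_getElem (by omega)] at hkx
        rw [List.getElem?_eq_getElem hk1] at hky
        have hxe : γ₁.walk.getVert k = x := by rw [e1]; exact Option.some.inj hkx
        have hye : γ₁.walk.getVert (k + 1) = y := by rw [e2]; exact Option.some.inj hky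
        have h := γ₁.walk.adj_getVert_succ (i := k)
          (by rw [SimpleGraph.Walk.length_support] at hk1; omega)
        rw [hxe, hye] at h
        exact (meshGraph_adj_iff.1 (discreteDomainGraph_adj_iff.1 h).1).1
      have hxin : dist (meshPoint δ x) c < r := by
        rw [← hxlast]; exact hinside _ (List.getLast_mem hinsne)
      have hxy : dist (meshPoint δ y) (meshPoint δ x) ≤ δ := by
        rw [dist_comm]; exact dist_meshPoint_le_of_adj hδ.le hadj
      have := dist_triangle (meshPoint δ y) (meshPoint δ x) c
      linarith
  have hEB : E ∩ B ∩ pf ⁻¹' {π} = {γ | C γ.walk.support ∧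
      γ.walk.support.drop (π.length - 1) ∈ {l | Φ l ∈ A}} := by
    rw [inter_assoc, inter_comm B, ← inter_assoc, hfib]
    ext γ
    simp only [mem_inter_iff, mem_setOf_eq, hB]
    constructor
    · rintro ⟨hCγ, hBγ⟩; exact ⟨hCγ, (hΦC γ hCγ).1 hBγ⟩
    · rintro ⟨hCγ, hBγ⟩; exact ⟨hCγ, (hΦC γ hCγ).2 hBγ⟩
  rw [hEB, hfib]
  -- Step 5: the prefix as a self-avoiding walk `α` from `a` to `y`
  have hylt : ins.length < γ₁.walk.support.length := by rw [hinslen]; exact hnlt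
  have hyv : γ₁.walk.getVert ins.length = y := by
    rw [getVert_eq_getElem_support γ₁.walk hylt, ← hyhead, houthead]
    simp [hinslen]
  set α : (discreteDomainGraph (Ω₀ \ K) δ).Walk a y := (γ₁.walk.take ins.length).copy rfl hyv with hα_def
  have hαsupp : α.support = π := by
    rw [hα_def, SimpleGraph.Walk.support_copy, SimpleGraph.Walk.support_take, hπ, hinslen,
      ← List.take_append_getElem hnlt, ← hins_def, ← houthead, hyhead]
  have hαpath : α.IsPath := by
    rw [SimpleGraph.Walk.isPath_def, hαsupp, hπ]
    have hnd : (ins ++ out).Nodup := hdec ▸ γ₁.isPath.support_nodup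
    rw [List.nodup_append] at hnd
    refine List.Nodup.append hnd.1 (List.nodup_singleton _) fun w hw hw' => ?_
    rw [List.mem_singleton] at hw'
    subst hw'
    have h1 := hinside _ hw
    have h2 := hallout (out.head houtne) (List.head_mem _)
    rw [hyhead] at h2
    linarith
  -- Step 6: apply the generalised cylinder factorisation
  have hsub : Ω₀ \ Ks ⊆ Ω₀ \ K := by
    intro z hz
    refine ⟨hz.1, fun hzK => hz.2 ?_⟩
    rw [hKs]; exact subset_screenData hδ.le hrρ hK hzK
  have hαKs : ∀ w ∈ α.support.dropLast, meshPoint δ w ∈ Ks := by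
    intro w hw
    rw [hαsupp, hπdrop] at hw
    have hwin := hinside w hw
    rw [hKs]
    refine ⟨mem_ball.2 hwin, ?_⟩
    rintro ⟨x', y', hadj, hx', hy', hseg⟩
    rcases eq_or_eq_of_meshPoint_mem_segment hδ.ne' hadj hseg with rfl | rfl <;> linarith
  have T1 := fun β' : DomainSAW (Ω₀ \ Ks) δ y b => transport_T1_gen α hαpath hb hsub hαKs β'
  have TC : ∀ β' : DomainSAW (Ω₀ \ Ks) δ y b, C (α.support.dropLast ++ β'.walk.support) := by
    intro β'
    refine ⟨?_, ?_⟩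
    · rw [hαsupp]
      refine prefix_dropLast_append hπne ?_
      rw [head?_support, hπlast]
    · intro w hw
      rw [hαsupp, drop_dropLast_append] at hw
      by_cases hnil : β'.walk.Nil
      · rw [SimpleGraph.Walk.nil_iff_support_eq.1 hnil, List.mem_singleton] at hw
        rw [hw, ← hyhead]; exact houthd
      · have hwv := meshDomain_subset_meshVertices _ _ (mem_meshDomain_of_mem_support β'.walk hnil hw)
        exact le_dist_of_not_mem_screenData hδ.ne' (hKs ▸ hwv.2)
  have T2 : ∀ γ : DomainSAW (Ω₀ \ K) δ a b, C γ.walk.support →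
      ∃ β' : DomainSAW (Ω₀ \ Ks) δ y b, γ.walk.support = α.support.dropLast ++ β'.walk.support := by
    rintro γ ⟨hpre, hout'⟩
    rw [← hαsupp] at hpre
    have hlen : α.length = π.length - 1 := by
      have := SimpleGraph.Walk.length_support α; rw [hαsupp] at this; omega
    exact screen_T2 hflat hδ (by linarith) α hKs hbs γ hpre (by rw [hlen]; exact hout')
  have key := law_split_gen (Ω := Ω₀ \ K) (Ω' := Ω₀ \ Ks) α.support C T1 TC T2
    (weight_univ_ne_top (hΩ₀.subset Set.sdiff_subset) hδ y b) {l | Φ l ∈ A}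
  have hαlen : α.support.length - 1 = π.length - 1 := by rw [hαsupp]
  rw [hαlen] at key
  calc law (Ω₀ \ K) δ a b {γ | C γ.walk.support ∧ γ.walk.support.drop (π.length - 1) ∈ {l | Φ l ∈ A}}
      = law (Ω₀ \ K) δ a b {γ | C γ.walk.support} *
          law (Ω₀ \ Ks) δ y b {β' | β'.walk.support ∈ {l | Φ l ∈ A}} := key
    _ = law (Ω₀ \ K) δ a b {γ | C γ.walk.support} * Q := rfl

end ScreenLaw

end Summit.CriticalPhenomena.SAWScalingLimit.Theorems.ScreeningRecursion

end
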